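import Mathlib
import HarnessLib
import Summits.Ventures.LatticeQCDFlow.Exactness.CPNHeatBathErgodic
import Summits.Ventures.LatticeQCDFlow.Exactness.VMFSiteHeatBathGeneral

/-!
# The CP(N−1) site conditional is the vMF law of the local field: the typed sampler IS the typed chain's heat bath

HONEST FRAMING: exact (Metropolis-corrected) sampling algorithms for lattice gauge theory;
figures of merit are autocorrelation/cost numbers at stated couplings and volumes; no
continuum-physics claim.

Venture `LatticeQCDFlow` (cell pub-lqcd), topic `Exactness`, FANOUT row 9 (eng-latcore, the
engine `latflow.core`).  NEW WORK of the cell over row 9's `CPNHeatBathErgodic.lean` (the lattice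
CP(N−1) action `cpnAction` and its heat-bath sweep) and `VMFSiteHeatBathGeneral.lean` (`vmfAt κ m`,
the law the engine's site sampler produces exactly).  Nothing is cited as a fact.

`CPNHeatBathErgodic.lean` proved that the sweep of EXACT single-variable heat baths converges to the
lattice CP(N−1) law and left as "LAW side, index bookkeeping" that the exact site conditional is the
law the engine samples.  This file does the bookkeeping (no self-loops `src e ≠ tgt e`, as on every
lattice):

* `cpnLocalField v ω` — the engine's local field `F_v = Σ_{e: src e = v} c_e(λ₀ z_t − λ₁ J z_t) +
  Σ_{e: tgt e = v} c_e(λ₀ z_s − λ₁ J† z_s)` (`cpn_kernel.c` `local_field`, realified; `J†` = the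
  adjoint, i.e. `−J = J†` for the complex structure); `cpnRestAction v ω` — the terms not touching `v`;
* **`cpnAction_eq`** — `S(ω) = −⟨z_v, F_v(ω)⟩ + R_v(ω)`;
* `localField_update`, `restAction_update` — `F_v` and `R_v` do not read `z_v`;
* **`gibbsDensity_cpnAction_update`** — THE CONDITIONAL WEIGHT OF SITE `v` IS `e^{⟨ξ, F_v⟩}` up to a
  factor constant in `ξ`: `e^{−S(ω | z_v := ξ)} = e^{⟨ξ, F_v(ω)⟩} · e^{−R_v(ω)}` (`ξ` read back by
  `siteVec`, `siteVec_update_self`); so row 9's exact site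
  heat bath (`siteHeatBath`, density `∝ e^{−S(ω|z_v := ξ)}` against the uniform sphere) redraws `z_v`
  from the density `∝ e^{⟨ξ, F_v⟩}` — and **`vmfAt_norm_smul`**: that is `vmfAt ‖F‖ (F/‖F‖)`, the von
  Mises–Fisher law with `κ = ‖F_v‖`, `m = F_v/‖F_v‖` which `map_siteHB` (Wood + Gaussian
  perpendicular) produces EXACTLY.  (Engine: `c_e = 2Nβ`, so `κ = 2Nβ‖F_eng‖`.)

NOT CLAIMED: the link conditional bookkeeping (von Mises with `κ = c_e|⟨z_s, z_t⟩_ℂ|`, analogous and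
simpler; sampler typed in `BestFisherAngle.lean`), the Symanzik action, floating point.
-/

namespace Summit.Ventures.LatticeQCDFlow.Exactness

open MeasureTheory ProbabilityTheory Metric Finset
open scoped ENNReal InnerProductSpace

section SiteConditional

variable {V E : Type*} [Fintype V] [Fintype E] [DecidableEq V] [DecidableEq E] {d : ℕ}
  (src tgt : E → V) (J : EuclideanSpace ℝ (Fin (d + 2)) →L[ℝ] EuclideanSpace ℝ (Fin (d + 2))) (c : E → ℝ)

/-- The summand of the action carried by link `e`. -/
noncomputable def cpnLinkTerm (ω : CPNConfig V E d) (e : E) : ℝ :=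
  c e * (linkVec ω e 0 * ⟪siteVec ω (src e), siteVec ω (tgt e)⟫_ℝ -
    linkVec ω e 1 * ⟪siteVec ω (src e), J (siteVec ω (tgt e))⟫_ℝ)

omit [Fintype V] [DecidableEq V] [DecidableEq E] in
/-- `S = −Σ_e cpnLinkTerm e`. -/
theorem cpnAction_eq_sum (ω : CPNConfig V E d) : cpnAction src tgt J c ω = -∑ e, cpnLinkTerm src tgt J c ω e := rfl

/-- **The local field at site `v`** (outgoing links see `z_{tgt}`, incoming links see `z_{src}` through
the adjoint of `J`). -/
noncomputable def cpnLocalField (v : V) (ω : CPNConfig V E d) : EuclideanSpace ℝ (Fin (d + 2)) :=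
  ∑ e ∈ univ.filter (fun e => src e = v),
      c e • (linkVec ω e 0 • siteVec ω (tgt e) - linkVec ω e 1 • J (siteVec ω (tgt e))) +
    ∑ e ∈ univ.filter (fun e => tgt e = v),
      c e • (linkVec ω e 0 • siteVec ω (src e) - linkVec ω e 1 • (ContinuousLinearMap.adjoint J) (siteVec ω (src e)))

/-- **The rest of the action**: the links not touching `v`. -/
noncomputable def cpnRestAction (v : V) (ω : CPNConfig V E d) : ℝ :=
  -∑ e ∈ univ.filter (fun e => src e ≠ v ∧ tgt e ≠ v), cpnLinkTerm src tgt J c ω e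

variable {src tgt}

omit [Fintype V] [Fintype E] [DecidableEq V] [DecidableEq E] in
/-- An outgoing link's term is `⟨z_v, c_e(λ₀ z_t − λ₁ J z_t)⟩`. -/
theorem linkTerm_of_src {v : V} {e : E} (he : src e = v) (ω : CPNConfig V E d) :
    cpnLinkTerm src tgt J c ω e =
      ⟪siteVec ω v, c e • (linkVec ω e 0 • siteVec ω (tgt e) - linkVec ω e 1 • J (siteVec ω (tgt e)))⟫_ℝ := by
  subst he
  rw [cpnLinkTerm, real_inner_smul_right, inner_sub_right, real_inner_smul_right, real_inner_smul_right]

omit [Fintype V] [Fintype E] [DecidableEq V] [DecidableEq E] in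
/-- An incoming link's term is `⟨z_v, c_e(λ₀ z_s − λ₁ J† z_s)⟩`. -/
theorem linkTerm_of_tgt {v : V} {e : E} (he : tgt e = v) (ω : CPNConfig V E d) :
    cpnLinkTerm src tgt J c ω e =
      ⟪siteVec ω v, c e • (linkVec ω e 0 • siteVec ω (src e) -
        linkVec ω e 1 • (ContinuousLinearMap.adjoint J) (siteVec ω (src e)))⟫_ℝ := by
  subst he
  rw [cpnLinkTerm, real_inner_smul_right, inner_sub_right, real_inner_smul_right, real_inner_smul_right,
    ContinuousLinearMap.adjoint_inner_right, real_inner_comm (siteVec ω (tgt e)) (siteVec ω (src e)),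
    real_inner_comm (J (siteVec ω (tgt e))) (siteVec ω (src e))]

omit [Fintype V] [DecidableEq E] in
/-- **Decomposition of the action at a site**: `S(ω) = −⟨z_v, F_v(ω)⟩ + R_v(ω)` (no self-loops). -/
theorem cpnAction_eq (hloop : ∀ e, src e ≠ tgt e) (v : V) (ω : CPNConfig V E d) :
    cpnAction src tgt J c ω = -⟪siteVec ω v, cpnLocalField src tgt J c v ω⟫_ℝ + cpnRestAction src tgt J c v ω := by
  rw [cpnAction_eq_sum, cpnRestAction, cpnLocalField, inner_add_right, inner_sum, inner_sum,
    ← sum_filter_add_sum_filter_not univ (fun e => src e = v),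
    ← sum_filter_add_sum_filter_not (univ.filter fun e => ¬src e = v) (fun e => tgt e = v),
    Finset.filter_filter, Finset.filter_filter]
  have h1 : ∑ e ∈ univ.filter (fun e => src e = v), cpnLinkTerm src tgt J c ω e =
      ∑ e ∈ univ.filter (fun e => src e = v),
        ⟪siteVec ω v, c e • (linkVec ω e 0 • siteVec ω (tgt e) - linkVec ω e 1 • J (siteVec ω (tgt e)))⟫_ℝ :=
    sum_congr rfl fun e he => linkTerm_of_src J c (mem_filter.1 he).2 ω
  have h2 : ∑ e ∈ univ.filter (fun e => ¬src e = v ∧ tgt e = v), cpnLinkTerm src tgt J c ω e =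
      ∑ e ∈ univ.filter (fun e => tgt e = v),
        ⟪siteVec ω v, c e • (linkVec ω e 0 • siteVec ω (src e) -
          linkVec ω e 1 • (ContinuousLinearMap.adjoint J) (siteVec ω (src e)))⟫_ℝ := by
    rw [show univ.filter (fun e => ¬src e = v ∧ tgt e = v) = univ.filter (fun e => tgt e = v) from
      filter_congr fun e _ => ⟨fun h => h.2, fun h => ⟨fun hs => hloop e (hs.trans h.symm), h⟩⟩]
    exact sum_congr rfl fun e he => linkTerm_of_tgt J c (mem_filter.1 he).2 ω
  have h3 : univ.filter (fun e => ¬src e = v ∧ ¬tgt e = v) = univ.filter (fun e => src e ≠ v ∧ tgt e ≠ v) := rfl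
  rw [h1, h2, h3]
  ring

/-! ## Locality: `F_v` and `R_v` do not read `z_v` -/

omit [Fintype V] [Fintype E] in
/-- Updating site `v` does not change the other sites … -/
theorem siteVec_update_of_ne {v w : V} (h : w ≠ v) (ω : CPNConfig V E d) (ξ : CPNVar V E d (Sum.inl v)) :
    siteVec (Function.update ω (Sum.inl v) ξ) w = siteVec ω w := by
  unfold siteVec
  rw [Function.update_of_ne (fun h' => h (Sum.inl_injective h'))]

omit [Fintype V] [Fintype E] in
/-- … reads back the new value at `v` … -/
theorem siteVec_update_self (v : V) (ω : CPNConfig V E d) (ξ : CPNVar V E d (Sum.inl v)) :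
    siteVec (Function.update ω (Sum.inl v) ξ) v = ξ.val := by
  unfold siteVec
  rw [Function.update_self]

omit [Fintype V] [Fintype E] in
/-- … and does not change the links. -/
theorem linkVec_update (v : V) (e : E) (ω : CPNConfig V E d) (ξ : CPNVar V E d (Sum.inl v)) :
    linkVec (Function.update ω (Sum.inl v) ξ) e = linkVec ω e := by
  unfold linkVec
  rw [Function.update_of_ne Sum.inr_ne_inl]

omit [Fintype V] in
/-- **The local field does not read `z_v`** (no self-loops). -/
theorem localField_update (hloop : ∀ e, src e ≠ tgt e) (v : V) (ω : CPNConfig V E d)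
    (ξ : CPNVar V E d (Sum.inl v)) :
    cpnLocalField src tgt J c v (Function.update ω (Sum.inl v) ξ) = cpnLocalField src tgt J c v ω := by
  unfold cpnLocalField
  congr 1
  · refine sum_congr rfl fun e he => ?_
    have hs : src e = v := (mem_filter.1 he).2
    have ht : tgt e ≠ v := fun h => hloop e (hs.trans h.symm)
    rw [linkVec_update, siteVec_update_of_ne ht]
  · refine sum_congr rfl fun e he => ?_
    have ht : tgt e = v := (mem_filter.1 he).2
    have hs : src e ≠ v := fun h => hloop e (h.trans ht.symm)
    rw [linkVec_update, siteVec_update_of_ne hs]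

omit [Fintype V] in
/-- **The rest of the action does not read `z_v`.** -/
theorem restAction_update (v : V) (ω : CPNConfig V E d) (ξ : CPNVar V E d (Sum.inl v)) :
    cpnRestAction src tgt J c v (Function.update ω (Sum.inl v) ξ) = cpnRestAction src tgt J c v ω := by
  unfold cpnRestAction
  congr 1
  refine sum_congr rfl fun e he => ?_
  obtain ⟨hs, ht⟩ := (mem_filter.1 he).2
  simp only [cpnLinkTerm, linkVec_update, siteVec_update_of_ne hs ω ξ, siteVec_update_of_ne ht ω ξ]

omit [Fintype V] in
/-- **THE CONDITIONAL WEIGHT OF SITE `v` IS `e^{⟨ξ, F_v⟩}` UP TO A FACTOR CONSTANT IN `ξ`**: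
`e^{−S(ω | z_v := ξ)} = e^{⟨ξ, F_v(ω)⟩} · e^{−R_v(ω)}` — so the exact site heat bath redraws `z_v` with
density `∝ e^{⟨ξ, F_v(ω)⟩}` against the uniform sphere. -/
theorem gibbsDensity_cpnAction_update (hloop : ∀ e, src e ≠ tgt e) (v : V) (ω : CPNConfig V E d)
    (ξ : CPNVar V E d (Sum.inl v)) :
    gibbsDensity (cpnAction src tgt J c) (Function.update ω (Sum.inl v) ξ) =
      ENNReal.ofReal (Real.exp ⟪siteVec (Function.update ω (Sum.inl v) ξ) v, cpnLocalField src tgt J c v ω⟫_ℝ) *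
        ENNReal.ofReal (Real.exp (-cpnRestAction src tgt J c v ω)) := by
  rw [gibbsDensity, cpnAction_eq J c hloop v, localField_update J c hloop, restAction_update,
    ← ENNReal.ofReal_mul (Real.exp_pos _).le, ← Real.exp_add]
  congr 2
  ring

/-- **… and that density is the von Mises–Fisher law of the local field**: for `F ≠ 0`,
`vmfAt ‖F‖ (F/‖F‖)` has density `e^{⟨x, F⟩}` — the law `VMFSiteHeatBathGeneral.map_siteHB` produces
exactly with `κ = ‖F‖`, `m = F/‖F‖` (for `F = 0`: the uniform law, `vmfAt 0 m` for any `m`). -/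
theorem vmfAt_norm_smul {F : EuclideanSpace ℝ (Fin (d + 2))} (hF : F ≠ 0) :
    vmfAt d ‖F‖ (‖F‖⁻¹ • F) =
      ((volume : Measure (EuclideanSpace ℝ (Fin (d + 2)))).toSphere).withDensity
        fun x => ENNReal.ofReal (Real.exp ⟪(x : EuclideanSpace ℝ (Fin (d + 2))), F⟫_ℝ) := by
  unfold vmfAt
  congr 1
  funext x
  rw [real_inner_smul_left, ← mul_assoc, mul_inv_cancel₀ (norm_ne_zero_iff.2 hF), one_mul, real_inner_comm]

end SiteConditional

end Summit.Ventures.LatticeQCDFlow.Exactness
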